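import Summits.Ventures.HSemireg.WedgeHankelRecurrenceGaussNewtonLeft

/-!
# Venture HSemireg — **CAUCHY INTERLACING FOR A DELETED INTERIOR INDEX (weak form, via the secular weights)**: with the minor polynomial `M = q_i · Q_m` of N357 (the characteristic polynomial
# of the Jacobi matrix of order `N = m + i + 1` with row and column `i` deleted) and the zeros `x_0 < ⋯ < x_{N−1}` of `q_N`: the derivative of `q_N` alternates in sign along the zeros,
# `M(x_k) M(x_{k+1}) ≤ 0`, so every closed gap `[x_k, x_{k+1}]` contains a zero of `M`, and `M` has no zero outside `[x_0, x_{N−1}]` (indeed `M > 0` to the right)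

HONEST FRAMING. Part of the Lean index of the computation cell `pub-hsemireg` (seat p10 gen 45, Sunday typer «UNIFORM-IN-n»).  Real polynomials, finite sums and the intermediate value theorem
(N239) only; no variety, no cohomology theory, no sheaf, no Ext group and no semiregularity map is constructed here; nothing here says that HC / HC_CM / HC_AV holds; no Literature fact (unproved
`Prop`) is declared or used.  Custodian versions as in `WedgeHankelSiegelIdeal` (1/3).
SOURCES (cited).  A.-L. Cauchy (1829), Œuvres (2) 9, 174–195; R. A. Horn, C. R. Johnson, *Matrix Analysis* (2nd ed.) Thm 4.3.17 (eigenvalues of a principal submatrix of order `n − 1` interlace);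
B. N. Parlett, *The Symmetric Eigenvalue Problem* (1980) §10.1; G. H. Golub, SIAM Rev. 15 (1973) §5; J. H. Wilkinson, *The Algebraic Eigenvalue Problem* (1965) Ch. 2 §41.
PROOF TYPED HERE.  `q_N'(x_k) q_{N−1}(x_k) > 0` (N274) and `q_{N−1}` alternates along the zeros of `q_N` (N279 via the recurrence `q_{N+1}(x_k) = −b_N q_{N−1}(x_k)`), so `q_N'(x_k) q_N'(x_{k+1}) < 0`;
`M(x_k) = ρ_k q_N'(x_k)` with `ρ_k ≥ 0` (N357), hence `M(x_k) M(x_{k+1}) ≤ 0` and the IVT (N239) places a zero in each closed gap; off the hull, `M(y)∕q_N(y) = Σ ρ_k∕(y − x_k)` (N357) is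
`≥ 1∕(y − x_0) > 0` resp. `≤ 1∕(y − x_{N−1}) < 0`.
DEDUP DISCLOSURE (`rg -n 'minor_interlace|derivative_signs_alternate|minor_zero' Summits/Ventures/HSemireg`, 2026-09-03): N356 (contiguous blocks), N279 (consecutive degrees); the deleted-index
form is new.  The 6 names below: 0 hits tree-wide.

WHAT IS IN THE TREE.  N239 `exists_root_Ioo_of_mul_eval_neg`; N274 `recurrence_christoffel_darboux_confluent_pos`; N279 `recurrence_zeros`, `recurrence_monic_natDegree`,
`eq_prod_X_sub_C_of_monic_of_roots`; N284 `eval_derivative_prod_X_sub_C_at_node`; N294 `strictMono_eq_of_prod_X_sub_C_eq`; N337 `eval_prod_X_sub_C_pos_of_gt`, `eval_prod_X_sub_C_sign_of_lt`;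
N357 `lagrange_partial_fraction_eval`, `rank_one_secular_weight_nonneg`, `rank_one_secular_weights_sum`.
THIS FILE (namespace `Summit.Ventures.HSemireg.Wedge.HankelOuter` continued; CHAINED on N364 (import only); 0 definitions):
* §1130 **`derivative_signs_alternate`** (`q_N'(x_k) q_N'(x_{k+1}) < 0` at consecutive zeros), `derivative_zero_mem_gap` (Rolle: a critical point in each open gap), `minor_eval_mul_nonpos` (`M(x_k) M(x_{k+1}) ≤ 0`), **`minor_zero_mem_gap`** (a zero of `M` in
  `[x_k, x_{k+1}]`), **`minor_eval_pos_of_gt`** (`M(y) > 0` for `y > x_{N−1}`), **`minor_eval_sign_of_lt`** (`(−1)^{N−1} M(y) > 0` for `y < x_0`).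
CAVEATS.  Positive recurrences; the weak form (closed gaps; exactly-one-per-gap counting is not typed).  Nothing Ext-side.  New names only.
-/

open Module Polynomial
open scoped Matrix Polynomial

namespace Summit.Ventures.HSemireg.Wedge.HankelOuter

/-! ## §1130. The minor polynomial interlaces -/

/-- **THE DERIVATIVE ALTERNATES ALONG THE ZEROS: `q_{t+1}'(x_k) · q_{t+1}'(x_{k+1}) < 0`** for consecutive zeros of a positive recurrence. [Szegő Thm 3.3.2 (proof); this file, §1130] -/
theorem derivative_signs_alternate {q : ℕ → ℝ[X]} {a b : ℕ → ℝ} (hq0 : q 0 = 1) (hq1 : q 1 = Polynomial.X - C (a 0))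
    (hrec : ∀ n, q (n + 2) = (Polynomial.X - C (a (n + 1))) * q (n + 1) - C (b (n + 1)) * q n) (hb : ∀ j, 0 < b j)
    {t : ℕ} {x : Fin (t + 1) → ℝ} (hx : StrictMono x) (hxq : q (t + 1) = ∏ j, (Polynomial.X - C (x j))) (k : Fin (t + 1)) (hk : (k : ℕ) + 1 ≤ t) :
    (derivative (q (t + 1))).eval (x k) * (derivative (q (t + 1))).eval (x ⟨k + 1, by omega⟩) < 0 := by
  -- identify `x` with the zero vector of N279 and read off the alternation of `q_{t+2}`, hence of `q_t`, at the zeros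
  obtain ⟨z, hz, hzr, hzs⟩ := recurrence_zeros hq0 hq1 hrec hb t
  obtain ⟨hm, hd⟩ := recurrence_monic_natDegree hq0 hq1 hrec (t + 1)
  have hzq := eq_prod_X_sub_C_of_monic_of_roots hm hd hz.injective hzr
  have hzx : z = x := strictMono_eq_of_prod_X_sub_C_eq hz hx (hzq.symm.trans hxq)
  subst hzx
  have hxr : ∀ j, (q (t + 1)).eval (z j) = 0 := hzr
  -- `q_{t+2}(x_j) = −b_{t+1} q_t(x_j)`
  have hlink : ∀ j, (q (t + 2)).eval (z j) = -b (t + 1) * (q t).eval (z j) := fun j => by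
    have h := congrArg (eval (z j)) (hrec t)
    simp only [eval_sub, eval_mul, eval_X, eval_C, hxr j, mul_zero, zero_sub] at h
    rw [h]; ring
  have hs0 := hzs k
  have hs1 := hzs ⟨k + 1, by omega⟩
  rw [hlink] at hs0 hs1
  simp only at hs1
  -- `q'_{t+1} q_t > 0` at each zero
  have hcd : ∀ j, 0 < (derivative (q (t + 1))).eval (z j) * (q t).eval (z j) := fun j => by
    have h := recurrence_christoffel_darboux_confluent_pos hq0 hq1 hrec hb t (z j)
    rwa [hxr j, mul_zero, sub_zero] at h
  have h0 := hcd k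
  have h1 := hcd ⟨k + 1, by omega⟩
  -- signs: `(−1)^{t+1+k} (−b) q_t(x_k) > 0` and `(−1)^{t+2+k} (−b) q_t(x_{k+1}) > 0` ⇒ `q_t(x_k) q_t(x_{k+1}) < 0`
  have hprod : (q t).eval (z k) * (q t).eval (z ⟨k + 1, by omega⟩) < 0 := by
    have e : ((-1 : ℝ) ^ (t + 1 + (k : ℕ)) * (-b (t + 1) * (q t).eval (z k))) * ((-1 : ℝ) ^ (t + 1 + ((k : ℕ) + 1)) * (-b (t + 1) * (q t).eval (z ⟨k + 1, by omega⟩))) =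
        -(b (t + 1) ^ 2 * ((-1 : ℝ) ^ (t + 1 + (k : ℕ))) ^ 2) * ((q t).eval (z k) * (q t).eval (z ⟨k + 1, by omega⟩)) := by ring
    have hpos := mul_pos hs0 hs1
    have hsq : ((-1 : ℝ) ^ (t + 1 + (k : ℕ))) ^ 2 = 1 := by rw [← pow_mul, mul_comm, pow_mul, neg_one_sq, one_pow]
    rw [e, hsq, mul_one] at hpos
    rcases pos_and_pos_or_neg_and_neg_of_mul_pos hpos with ⟨h1', -⟩ | ⟨-, h2'⟩
    · exfalso; have := pow_pos (hb (t + 1)) 2; linarith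
    · exact h2'
  nlinarith [mul_pos h0 h1]

/-- **ROLLE, CONCRETELY: each open gap `(x_k, x_{k+1})` contains a critical point of `q_{t+1}`.** [this file, §1130] -/
theorem derivative_zero_mem_gap {q : ℕ → ℝ[X]} {a b : ℕ → ℝ} (hq0 : q 0 = 1) (hq1 : q 1 = Polynomial.X - C (a 0))
    (hrec : ∀ n, q (n + 2) = (Polynomial.X - C (a (n + 1))) * q (n + 1) - C (b (n + 1)) * q n) (hb : ∀ j, 0 < b j)
    {t : ℕ} {x : Fin (t + 1) → ℝ} (hx : StrictMono x) (hxq : q (t + 1) = ∏ j, (Polynomial.X - C (x j))) (k : Fin (t + 1)) (hk : (k : ℕ) + 1 ≤ t) :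
    ∃ η, x k < η ∧ η < x ⟨k + 1, by omega⟩ ∧ (derivative (q (t + 1))).eval η = 0 := by
  obtain ⟨η, h1, h2, h3⟩ := exists_root_Ioo_of_mul_eval_neg (hx (Fin.lt_def.2 (by simp))) (derivative_signs_alternate hq0 hq1 hrec hb hx hxq k hk)
  exact ⟨η, h1, h2, h3⟩

/-- **`M(x_k) · M(x_{k+1}) ≤ 0`** for the minor polynomial `M = q_i Q_m` at consecutive zeros of `q_{m+i+1}`. [this file, §1130] -/
theorem minor_eval_mul_nonpos {q Q : ℕ → ℝ[X]} {a b A B : ℕ → ℝ} (hq0 : q 0 = 1) (hq1 : q 1 = Polynomial.X - C (a 0))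
    (hrec : ∀ n, q (n + 2) = (Polynomial.X - C (a (n + 1))) * q (n + 1) - C (b (n + 1)) * q n)
    (hQ0 : Q 0 = 1) (hQ1 : Q 1 = Polynomial.X - C (A 0)) (hQrec : ∀ n, Q (n + 2) = (Polynomial.X - C (A (n + 1))) * Q (n + 1) - C (B (n + 1)) * Q n)
    (hb : ∀ j, 0 < b j) {i : ℕ} (hA : ∀ n, A n = a (n + i + 1)) (hB : ∀ n, B n = b (n + i + 1))
    (m : ℕ) {x : Fin (m + i + 1) → ℝ} (hx : StrictMono x) (hxq : q (m + i + 1) = ∏ k, (Polynomial.X - C (x k))) (k : Fin (m + i + 1)) (hk : (k : ℕ) + 1 ≤ m + i) :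
    (q i * Q m).eval (x k) * (q i * Q m).eval (x ⟨k + 1, by omega⟩) ≤ 0 := by
  have hD : ∀ j : Fin (m + i + 1), ∏ l ∈ Finset.univ.erase j, (x j - x l) = (derivative (q (m + i + 1))).eval (x j) := fun j => by rw [hxq, eval_derivative_prod_X_sub_C_at_node]
  have hρ := rank_one_secular_weight_nonneg hq0 hq1 hrec hQ0 hQ1 hQrec hb hA hB m hxq
  have hDne : ∀ j : Fin (m + i + 1), ∏ l ∈ Finset.univ.erase j, (x j - x l) ≠ 0 := fun j =>
    Finset.prod_ne_zero_iff.2 fun l hl => sub_ne_zero.2 fun e => (Finset.mem_erase.1 hl).1 (hx.injective e).symm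
  have hM : ∀ j : Fin (m + i + 1), (q i * Q m).eval (x j) = ((q i * Q m).eval (x j) / ∏ l ∈ Finset.univ.erase j, (x j - x l)) * (derivative (q (m + i + 1))).eval (x j) := fun j => by
    rw [← hD j, div_mul_cancel₀ _ (hDne j)]
  have halt := derivative_signs_alternate hq0 hq1 hrec hb hx hxq k hk
  rw [hM k, hM ⟨k + 1, by omega⟩]
  have h1 := hρ k
  have h2 := hρ ⟨k + 1, by omega⟩
  nlinarith [mul_nonneg h1 h2]

/-- **CAUCHY INTERLACING, DELETED INDEX `i`: every closed gap `[x_k, x_{k+1}]` of the zeros of `q_N` contains a zero of the minor polynomial `M = q_i Q_{N−1−i}`.** [Cauchy 1829; Horn–Johnson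
Thm 4.3.17; this file, §1130] -/
theorem minor_zero_mem_gap {q Q : ℕ → ℝ[X]} {a b A B : ℕ → ℝ} (hq0 : q 0 = 1) (hq1 : q 1 = Polynomial.X - C (a 0))
    (hrec : ∀ n, q (n + 2) = (Polynomial.X - C (a (n + 1))) * q (n + 1) - C (b (n + 1)) * q n)
    (hQ0 : Q 0 = 1) (hQ1 : Q 1 = Polynomial.X - C (A 0)) (hQrec : ∀ n, Q (n + 2) = (Polynomial.X - C (A (n + 1))) * Q (n + 1) - C (B (n + 1)) * Q n)
    (hb : ∀ j, 0 < b j) {i : ℕ} (hA : ∀ n, A n = a (n + i + 1)) (hB : ∀ n, B n = b (n + i + 1))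
    (m : ℕ) {x : Fin (m + i + 1) → ℝ} (hx : StrictMono x) (hxq : q (m + i + 1) = ∏ k, (Polynomial.X - C (x k))) (k : Fin (m + i + 1)) (hk : (k : ℕ) + 1 ≤ m + i) :
    ∃ ζ, x k ≤ ζ ∧ ζ ≤ x ⟨k + 1, by omega⟩ ∧ (q i * Q m).eval ζ = 0 := by
  have h := minor_eval_mul_nonpos hq0 hq1 hrec hQ0 hQ1 hQrec hb hA hB m hx hxq k hk
  have hlt : x k < x ⟨k + 1, by omega⟩ := hx (Fin.lt_def.2 (by simp))
  rcases h.lt_or_eq with hneg | hzero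
  · obtain ⟨ζ, h1, h2, h3⟩ := exists_root_Ioo_of_mul_eval_neg hlt hneg
    exact ⟨ζ, h1.le, h2.le, h3⟩
  · rcases mul_eq_zero.1 hzero with h0 | h0
    · exact ⟨x k, le_rfl, hlt.le, h0⟩
    · exact ⟨x ⟨k + 1, by omega⟩, hlt.le, le_rfl, h0⟩

/-- **No zero to the right: `M(y) > 0` for `y > x_{N−1}`** (`M(y)∕q_N(y) = Σ ρ_k∕(y − x_k) ≥ 1∕(y − x_0) > 0`). [this file, §1130] -/
theorem minor_eval_pos_of_gt {q Q : ℕ → ℝ[X]} {a b A B : ℕ → ℝ} (hq0 : q 0 = 1) (hq1 : q 1 = Polynomial.X - C (a 0))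
    (hrec : ∀ n, q (n + 2) = (Polynomial.X - C (a (n + 1))) * q (n + 1) - C (b (n + 1)) * q n)
    (hQ0 : Q 0 = 1) (hQ1 : Q 1 = Polynomial.X - C (A 0)) (hQrec : ∀ n, Q (n + 2) = (Polynomial.X - C (A (n + 1))) * Q (n + 1) - C (B (n + 1)) * Q n)
    (hb : ∀ j, 0 < b j) {i : ℕ} (hA : ∀ n, A n = a (n + i + 1)) (hB : ∀ n, B n = b (n + i + 1))
    (m : ℕ) {x : Fin (m + i + 1) → ℝ} (hx : StrictMono x) (hxq : q (m + i + 1) = ∏ k, (Polynomial.X - C (x k))) {y : ℝ} (hy : x (Fin.last (m + i)) < y) :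
    0 < (q i * Q m).eval y := by
  have hall : ∀ k, x k < y := fun k => (hx.monotone (Fin.le_last k)).trans_lt hy
  have hMd : (q i * Q m).natDegree ≤ m + i := by
    obtain ⟨hqm, hqd⟩ := recurrence_monic_natDegree hq0 hq1 hrec i
    obtain ⟨hQm, hQd⟩ := recurrence_monic_natDegree hQ0 hQ1 hQrec m
    rw [hqm.natDegree_mul hQm, hqd, hQd]; omega
  have hfrac := lagrange_partial_fraction_eval hx.injective hMd (fun k => (hall k).ne')
  have hqpos : 0 < (∏ j, (Polynomial.X - C (x j))).eval y := eval_prod_X_sub_C_pos_of_gt hall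
  have hρ := rank_one_secular_weight_nonneg hq0 hq1 hrec hQ0 hQ1 hQrec hb hA hB m hxq
  have hsum := rank_one_secular_weights_sum hq0 hq1 hrec hQ0 hQ1 hQrec m i hx.injective
  -- the sum is at least `1∕(y − x_0)`
  have hge : (1 : ℝ) / (y - x 0) ≤ ∑ k, ((q i * Q m).eval (x k) / ∏ j ∈ Finset.univ.erase k, (x k - x j)) / (y - x k) := by
    rw [← hsum, Finset.sum_div]
    refine Finset.sum_le_sum fun k _ => div_le_div_of_nonneg_left (hρ k) (sub_pos.2 (hall k)) (by linarith [hx.monotone (Fin.zero_le k)])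
  have hpos : 0 < ∑ k, ((q i * Q m).eval (x k) / ∏ j ∈ Finset.univ.erase k, (x k - x j)) / (y - x k) :=
    lt_of_lt_of_le (div_pos one_pos (sub_pos.2 (hall 0))) hge
  rw [← hfrac] at hpos
  exact (div_pos_iff_of_pos_right hqpos).1 hpos

/-- **No zero to the left: `(−1)^{N−1} M(y) > 0` for `y < x_0`.** [this file, §1130] -/
theorem minor_eval_sign_of_lt {q Q : ℕ → ℝ[X]} {a b A B : ℕ → ℝ} (hq0 : q 0 = 1) (hq1 : q 1 = Polynomial.X - C (a 0))
    (hrec : ∀ n, q (n + 2) = (Polynomial.X - C (a (n + 1))) * q (n + 1) - C (b (n + 1)) * q n)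
    (hQ0 : Q 0 = 1) (hQ1 : Q 1 = Polynomial.X - C (A 0)) (hQrec : ∀ n, Q (n + 2) = (Polynomial.X - C (A (n + 1))) * Q (n + 1) - C (B (n + 1)) * Q n)
    (hb : ∀ j, 0 < b j) {i : ℕ} (hA : ∀ n, A n = a (n + i + 1)) (hB : ∀ n, B n = b (n + i + 1))
    (m : ℕ) {x : Fin (m + i + 1) → ℝ} (hx : StrictMono x) (hxq : q (m + i + 1) = ∏ k, (Polynomial.X - C (x k))) {y : ℝ} (hy : y < x 0) :
    0 < (-1 : ℝ) ^ (m + i) * (q i * Q m).eval y := by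
  have hall : ∀ k, y < x k := fun k => hy.trans_le (hx.monotone (Fin.zero_le k))
  have hMd : (q i * Q m).natDegree ≤ m + i := by
    obtain ⟨hqm, hqd⟩ := recurrence_monic_natDegree hq0 hq1 hrec i
    obtain ⟨hQm, hQd⟩ := recurrence_monic_natDegree hQ0 hQ1 hQrec m
    rw [hqm.natDegree_mul hQm, hqd, hQd]; omega
  have hfrac := lagrange_partial_fraction_eval hx.injective hMd (fun k => (hall k).ne)
  have hqsign : 0 < (-1 : ℝ) ^ (m + i + 1) * (∏ j, (Polynomial.X - C (x j))).eval y := eval_prod_X_sub_C_sign_of_lt hall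
  have hρ := rank_one_secular_weight_nonneg hq0 hq1 hrec hQ0 hQ1 hQrec hb hA hB m hxq
  have hsum := rank_one_secular_weights_sum hq0 hq1 hrec hQ0 hQ1 hQrec m i hx.injective
  -- the sum is at most `1∕(y − x_{N−1}) < 0`
  have hle : ∑ k, ((q i * Q m).eval (x k) / ∏ j ∈ Finset.univ.erase k, (x k - x j)) / (y - x k) ≤ (1 : ℝ) / (y - x (Fin.last (m + i))) := by
    rw [← hsum, Finset.sum_div]
    refine Finset.sum_le_sum fun k _ => ?_
    rw [show y - x k = -(x k - y) by ring, show y - x (Fin.last (m + i)) = -(x (Fin.last (m + i)) - y) by ring, div_neg, div_neg, neg_le_neg_iff]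
    exact div_le_div_of_nonneg_left (hρ k) (sub_pos.2 (hall k)) (by linarith [hx.monotone (Fin.le_last k)])
  have hneg : ∑ k, ((q i * Q m).eval (x k) / ∏ j ∈ Finset.univ.erase k, (x k - x j)) / (y - x k) < 0 :=
    lt_of_le_of_lt hle (div_neg_of_pos_of_neg one_pos (sub_neg.2 (hall _)))
  rw [← hfrac] at hneg
  -- `M(y)` and `q_N(y)` have opposite signs, and `(−1)^{N} q_N(y) > 0`
  have hq0' : (∏ j, (Polynomial.X - C (x j))).eval y ≠ 0 := by
    rw [eval_prod]; exact Finset.prod_ne_zero_iff.2 fun k _ => by rw [eval_sub, eval_X, eval_C]; exact sub_ne_zero.2 (hall k).ne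
  have hMq : (q i * Q m).eval y * (∏ j, (Polynomial.X - C (x j))).eval y < 0 := by
    have := mul_neg_of_neg_of_pos hneg (mul_self_pos.2 hq0')
    rwa [div_mul_eq_mul_div, mul_div_assoc, mul_self_div_self] at this
  rw [pow_succ] at hqsign
  nlinarith [hqsign, hMq, sq_nonneg ((-1 : ℝ) ^ (m + i)), pow_mul_pow_eq_one (m + i) (show (-1 : ℝ) * (-1) = 1 by norm_num)]

end Summit.Ventures.HSemireg.Wedge.HankelOuter
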